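import Summits.MatrixMultiplication.OmegaCensus.Z4Z4Characters
import HarnessLib

/-!
# No domino cube law triple with a part of size `3` over `A ↠ ℤ₄ × ℤ₄`

ω-census `pub-omega`, family (b3), seat pub-omega-group gen 14.  Framing: lottery ticket; floor = certified bounds/negative
ranges.  VALUE: a kernel theorem about the group-theoretic method (TPP capacity of dihedral-like groups) closing an infinite
column of census cells; NOT progress on ω.

**Theorem (`no_law_cube_13e_of_onto_z4z4`, `no_law_cube_1d3_of_onto_z4z4`).** Let `G` be dihedral-like over a finite
abelian group `A` (presentation `ρ, τ : A → G`, ANY `c₀`) and suppose `A` maps onto `ZMod 4 × ZMod 4`.  Then no TPP triple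
`(S, T, U)` with coset parts of sizes `(1,1 | 3,3 | e,e)` or `(1,1 | d,d | 3,3)` attains the law `3|S||T||U| + 8 = 8|A|`.

Census use.  The Dih-side cells `(1,3,7)` over `ℤ₈²`, `ℤ₄ × ℤ₁₆` (`|A| = 64`, hitherto computational ×2, NR58), `(1,3,23)` over
`ℤ₄² × ℤ₁₃` (`208`, NR65), `(1,3,39)` over `ℤ₄ × ℤ₈ × ℤ₁₁` (`352`), and `(1,3,55 | 71 | 87 | 103)` at `|A| = 496, 640, 784, 928`
(all `A` of `2`-rank `2` with both `2`-exponents `≥ 2`) are theorem-closed; the groups of `2`-rank `≥ 3` were already excluded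
by `no_mod_one_law_of_rank_three`.

*Proof.*  By `domino_shifted_form_of_law` there are `X, Y ⊆ A` (`|X| = 3`, `|Y| = e` odd), shifts `β, γ` and a point `x₀`
with `(X+Y) ⊔ (β + (Y−X)) ⊔ (γ + (X−Y)) = A ∖ {x₀}`, all three sets direct.  For every character `ψ` of `A` pulled back from
`Q = ℤ₄²` (values in the Gaussian integers `ℤ[i]`), summing `ψ` over this partition gives, with `a = ψ(X)`, `b = ψ(Y)`,
`(E_ψ)  a b + ψ(β) ā b + ψ(γ) a b̄ = −ψ(x₀)` (`shifted_form_charsum`).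
* Real `ψ` (three of them): `ā = a`, `b̄ = b`, so `a b (1 + ψβ + ψγ) = −ψ(x₀)`; as `3` does not divide a unit of `ℤ[i]`,
  `(ψβ, ψγ) ≠ (1,1)` and the three points `x, y, z` of `X` are pairwise incongruent mod `2Q` — so there are `w, w' ∈ Q`
  pairing with `(φ(y−x), φ(z−x))` to `(1,0)` and `(0,1)` (`exists_dual_pair`).
* For `ψ = ψ_w`: `a = ζ(2+i)` (`ζ = ψ_w(x)` a unit).  `(E_ψ)` and its conjugate give `Det · b = N` (`det_mul_eq`) with
  `Det = |a|² + 2 Re(ψ(β) ā²) ∈ {11, 13, −1, −3}` and `|N|² ≤ 45`; `b ≠ 0` (it is odd), so `Det ∈ {−1, −3}`, i.e.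
  `ψ_w(β) ∈ ζ²·{−1, −i}` (`table_two_add_i`); likewise `ψ_{w'}(β) ∈ ζ'²{−1,−i}` and (with `a = ζζ'(1+2i)`,
  `table_one_add_two_i`) `ψ_{w+w'}(β) ∈ (ζζ')²{1, −i}`.  Multiplying: `ψ_w(β)² = ψ_{w'}(β)² = 1`
  (`two_mul_eq_zero_of_exclusions`), hence the three real characters `ψ_{2w}, ψ_{2w'}, ψ_{2w+2w'}` are `1` at `β`, so all
  three are `≠ 1` at `γ` — impossible, their product is trivial.  ∎
All finite bookkeeping over `ℤ₄` exponents is done by `decide` in `ℤ[i]` (`Z4Z4Characters.lean`).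
-/

namespace Summit.MatrixMultiplication.OmegaCensus

open Finset

/-! ## No shifted domino form with `|X| = 3` over `A ↠ ℤ₄²` -/

section Main

variable {A : Type*} [AddCommGroup A] [Fintype A] [DecidableEq A]

/-- **Core theorem.**  `A ↠ ZMod 4 × ZMod 4`; `X` of size `3`, `Y` of odd size, `β, γ, x₀` with `X + Y` direct and
`(X+Y) ⊔ (β + (Y−X)) ⊔ (γ + (X−Y)) = A ∖ {x₀}`.  Then `False`. [folklore] -/
theorem no_shifted_form_three_of_onto_z4z4 (φ : A →+ ZMod 4 × ZMod 4) (hφ : Function.Surjective φ)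
    {X Y : Finset A} {β γ x₀ : A} (hX : X.card = 3) (hY : Odd Y.card)
    (hinj : Set.InjOn (fun p : A × A => p.1 + p.2) ↑(X ×ˢ Y))
    (hPQ : Disjoint ((X ×ˢ Y).image fun p : A × A => p.1 + p.2)
      (((Y ×ˢ X).image fun p : A × A => p.1 - p.2).image fun z => z + β))
    (hPR : Disjoint ((X ×ˢ Y).image fun p : A × A => p.1 + p.2)
      (((X ×ˢ Y).image fun p : A × A => p.1 - p.2).image fun z => z + γ))
    (hQR : Disjoint (((Y ×ˢ X).image fun p : A × A => p.1 - p.2).image fun z => z + β)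
      (((X ×ˢ Y).image fun p : A × A => p.1 - p.2).image fun z => z + γ))
    (hcover : ((X ×ˢ Y).image fun p : A × A => p.1 + p.2) ∪
      (((Y ×ˢ X).image fun p : A × A => p.1 - p.2).image fun z => z + β) ∪
      (((X ×ˢ Y).image fun p : A × A => p.1 - p.2).image fun z => z + γ) = univ.erase x₀) : False := by
  classical
  obtain ⟨x, y, z, hxy, hxz, hyz, rfl⟩ := card_eq_three.1 hX
  -- the pulled-back characters `ψ w a = i^⟨w, φ a⟩` as an opaque local function
  obtain ⟨ψ, hψ⟩ : ∃ ψ : ZMod 4 × ZMod 4 → A → GaussianInt,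
      ∀ w a, ψ w a = (⟨0, 1⟩ : GaussianInt) ^ (w.1 * (φ a).1 + w.2 * (φ a).2).val := ⟨_, fun _ _ => rfl⟩
  have hψadd : ∀ w a b, ψ w (a + b) = ψ w a * ψ w b := fun w a b => by
    rw [hψ, hψ, hψ]; exact z4char_add φ w a b
  have hψneg : ∀ w a, ψ w (-a) = star (ψ w a) := fun w a => by rw [hψ, hψ]; exact z4char_neg φ w a
  have hψsum : ∀ w, w ≠ 0 → ∑ a, ψ w a = 0 := fun w hw => by
    simp only [hψ]; exact z4char_sum_eq_zero φ hφ w hw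
  -- the identity `(E_w)` for every `w ≠ 0`
  have E : ∀ w : ZMod 4 × ZMod 4, w ≠ 0 →
      (ψ w x + ψ w y + ψ w z) * (∑ v ∈ Y, ψ w v) +
        ψ w β * star (ψ w x + ψ w y + ψ w z) * (∑ v ∈ Y, ψ w v) +
        ψ w γ * (ψ w x + ψ w y + ψ w z) * star (∑ v ∈ Y, ψ w v) + ψ w x₀ = 0 := by
    intro w hw
    have h := shifted_form_charsum (ψ w) (hψadd w) hinj hPQ hPR hQR hcover
    rw [hψsum w hw, sum_insert (by simp [hxy, hxz]), sum_pair hyz, sum_insert (by simp [hxy, hxz]),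
      sum_pair hyz] at h
    simp only [hψneg] at h
    rw [star_add, star_add, star_sum]
    linear_combination -h
  -- `ψ_w(y) = ψ_w(x) i^⟨w, φ(y−x)⟩`, `ψ_w(z) = ψ_w(x) i^⟨w, φ(z−x)⟩`
  have hψy : ∀ w : ZMod 4 × ZMod 4,
      ψ w y = ψ w x * (⟨0, 1⟩ : GaussianInt) ^ (w.1 * (φ (y - x)).1 + w.2 * (φ (y - x)).2).val := fun w => by
    rw [← hψ, ← hψadd, add_sub_cancel]
  have hψz : ∀ w : ZMod 4 × ZMod 4,
      ψ w z = ψ w x * (⟨0, 1⟩ : GaussianInt) ^ (w.1 * (φ (z - x)).1 + w.2 * (φ (z - x)).2).val := fun w => by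
    rw [← hψ, ← hψadd, add_sub_cancel]
  -- (R) real characters: `3 ∤ unit`
  have three_ndvd : ∀ (c : GaussianInt) (w : ZMod 4 × ZMod 4) (a : A), 3 * c ≠ -ψ w a := by
    intro c w a h
    have := congrArg Zsqrtd.norm h
    rw [Zsqrtd.norm_mul, Zsqrtd.norm_neg, hψ, norm_ipow] at this
    have h9 : (3 : GaussianInt).norm = 9 := by decide
    rw [h9] at this
    omega
  have R1 : ∀ w : ZMod 4 × ZMod 4, w ≠ 0 → (∀ a, star (ψ w a) = ψ w a) →
      ¬ ((⟨0, 1⟩ : GaussianInt) ^ (w.1 * (φ (y - x)).1 + w.2 * (φ (y - x)).2).val = 1 ∧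
         (⟨0, 1⟩ : GaussianInt) ^ (w.1 * (φ (z - x)).1 + w.2 * (φ (z - x)).2).val = 1) := by
    rintro w hw hreal ⟨h1, h2⟩
    have h := E w hw
    rw [hψy, hψz, h1, h2, mul_one] at h
    simp only [star_add, star_sum, hreal] at h
    apply three_ndvd (ψ w x * (∑ v ∈ Y, ψ w v) * (1 + ψ w β + ψ w γ)) w x₀
    linear_combination h
  have R2 : ∀ w : ZMod 4 × ZMod 4, w ≠ 0 → (∀ a, star (ψ w a) = ψ w a) → ¬ (ψ w β = 1 ∧ ψ w γ = 1) := by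
    rintro w hw hreal ⟨h1, h2⟩
    have h := E w hw
    rw [h1, h2] at h
    simp only [star_add, star_sum, hreal] at h
    apply three_ndvd ((ψ w x + ψ w y + ψ w z) * ∑ v ∈ Y, ψ w v) w x₀
    linear_combination h
  have hreal2 : ∀ w : ZMod 4 × ZMod 4, ∀ a, star (ψ (w + w) a) = ψ (w + w) a := fun w a => by
    rw [hψ, z4pair_two, star_ipow_two_mul]
  -- coordinates `w, w'`
  have e20 : ∀ q : ZMod 4 × ZMod 4, ((1, 0) + (1, 0) : ZMod 4 × ZMod 4).1 * q.1 +
      ((1, 0) + (1, 0) : ZMod 4 × ZMod 4).2 * q.2 = 2 * q.1 + 0 * q.2 := fun q => by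
    simp only [Prod.mk_add_mk]; ring
  have e02 : ∀ q : ZMod 4 × ZMod 4, ((0, 1) + (0, 1) : ZMod 4 × ZMod 4).1 * q.1 +
      ((0, 1) + (0, 1) : ZMod 4 × ZMod 4).2 * q.2 = 0 * q.1 + 2 * q.2 := fun q => by
    simp only [Prod.mk_add_mk]; ring
  have e22 : ∀ q : ZMod 4 × ZMod 4, ((1, 1) + (1, 1) : ZMod 4 × ZMod 4).1 * q.1 +
      ((1, 1) + (1, 1) : ZMod 4 × ZMod 4).2 * q.2 = 2 * q.1 + 2 * q.2 := fun q => by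
    simp only [Prod.mk_add_mk]; ring
  obtain ⟨w, w', hwP, hwQ, hw'P, hw'Q⟩ := exists_dual_pair (φ (y - x)) (φ (z - x))
    (by rw [← e20, ← e20]; exact R1 _ (by decide) (hreal2 _))
    (by rw [← e02, ← e02]; exact R1 _ (by decide) (hreal2 _))
    (by rw [← e22, ← e22]; exact R1 _ (by decide) (hreal2 _))
  have hw0 : w ≠ 0 := by
    rintro rfl
    simp only [Prod.fst_zero, Prod.snd_zero, zero_mul, add_zero] at hwP; exact absurd hwP (by decide)
  have hw'0 : w' ≠ 0 := by
    rintro rfl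
    simp only [Prod.fst_zero, Prod.snd_zero, zero_mul, add_zero] at hw'Q; exact absurd hw'Q (by decide)
  have hww'P : (w + w').1 * (φ (y - x)).1 + (w + w').2 * (φ (y - x)).2 = 1 := by
    rw [z4pair_add_left, hwP, hw'P, add_zero]
  have hww'Q : (w + w').1 * (φ (z - x)).1 + (w + w').2 * (φ (z - x)).2 = 1 := by
    rw [z4pair_add_left, hwQ, hw'Q, zero_add]
  have hww'0 : w + w' ≠ 0 := by
    intro h; rw [h] at hww'P
    simp only [Prod.fst_zero, Prod.snd_zero, zero_mul, add_zero] at hww'P; exact absurd hww'P (by decide)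
  -- the three character sums of `X`
  have haw : ψ w x + ψ w y + ψ w z = ψ w x * ⟨2, 1⟩ := by
    rw [hψy, hψz, hwP, hwQ, gi_two_one]; ring
  have haw' : ψ w' x + ψ w' y + ψ w' z = ψ w' x * ⟨2, 1⟩ := by
    rw [hψy, hψz, hw'P, hw'Q, gi_two_one]; ring
  have haww' : ψ (w + w') x + ψ (w + w') y + ψ (w + w') z = ψ (w + w') x * ⟨1, 2⟩ := by
    rw [hψy, hψz, hww'P, hww'Q, gi_one_two]; ring
  -- exclusions from the tables
  have X1 : ¬ ((w.1 * (φ β).1 + w.2 * (φ β).2) - 2 * (w.1 * (φ x).1 + w.2 * (φ x).2) = 0 ∨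
      (w.1 * (φ β).1 + w.2 * (φ β).2) - 2 * (w.1 * (φ x).1 + w.2 * (φ x).2) = 1) := by
    intro hbad
    obtain ⟨hD, hN⟩ := table_two_add_i (w.1 * (φ x).1 + w.2 * (φ x).2) (w.1 * (φ β).1 + w.2 * (φ β).2)
      (w.1 * (φ γ).1 + w.2 * (φ γ).2) (w.1 * (φ x₀).1 + w.2 * (φ x₀).2) hbad
    have h := E w hw0
    rw [haw] at h
    have h' := det_mul_eq (ψ w x * ⟨2, 1⟩ + ψ w β * star (ψ w x * ⟨2, 1⟩)) (ψ w γ * (ψ w x * ⟨2, 1⟩))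
      (-ψ w x₀) (∑ v ∈ Y, ψ w v) (by linear_combination h)
    simp only [hψ] at h'
    exact z4char_sum_ne_zero φ w hY (eq_zero_of_det_mul h' hD hN)
  have X2 : ¬ ((w'.1 * (φ β).1 + w'.2 * (φ β).2) - 2 * (w'.1 * (φ x).1 + w'.2 * (φ x).2) = 0 ∨
      (w'.1 * (φ β).1 + w'.2 * (φ β).2) - 2 * (w'.1 * (φ x).1 + w'.2 * (φ x).2) = 1) := by
    intro hbad
    obtain ⟨hD, hN⟩ := table_two_add_i (w'.1 * (φ x).1 + w'.2 * (φ x).2) (w'.1 * (φ β).1 + w'.2 * (φ β).2)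
      (w'.1 * (φ γ).1 + w'.2 * (φ γ).2) (w'.1 * (φ x₀).1 + w'.2 * (φ x₀).2) hbad
    have h := E w' hw'0
    rw [haw'] at h
    have h' := det_mul_eq (ψ w' x * ⟨2, 1⟩ + ψ w' β * star (ψ w' x * ⟨2, 1⟩)) (ψ w' γ * (ψ w' x * ⟨2, 1⟩))
      (-ψ w' x₀) (∑ v ∈ Y, ψ w' v) (by linear_combination h)
    simp only [hψ] at h'
    exact z4char_sum_ne_zero φ w' hY (eq_zero_of_det_mul h' hD hN)
  have X3 : ¬ (((w.1 * (φ β).1 + w.2 * (φ β).2) + (w'.1 * (φ β).1 + w'.2 * (φ β).2)) -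
        2 * ((w.1 * (φ x).1 + w.2 * (φ x).2) + (w'.1 * (φ x).1 + w'.2 * (φ x).2)) = 1 ∨
      ((w.1 * (φ β).1 + w.2 * (φ β).2) + (w'.1 * (φ β).1 + w'.2 * (φ β).2)) -
        2 * ((w.1 * (φ x).1 + w.2 * (φ x).2) + (w'.1 * (φ x).1 + w'.2 * (φ x).2)) = 2) := by
    intro hbad
    rw [← z4pair_add_left, ← z4pair_add_left] at hbad
    obtain ⟨hD, hN⟩ := table_one_add_two_i ((w + w').1 * (φ x).1 + (w + w').2 * (φ x).2)
      ((w + w').1 * (φ β).1 + (w + w').2 * (φ β).2) ((w + w').1 * (φ γ).1 + (w + w').2 * (φ γ).2)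
      ((w + w').1 * (φ x₀).1 + (w + w').2 * (φ x₀).2) hbad
    have h := E (w + w') hww'0
    rw [haww'] at h
    have h' := det_mul_eq (ψ (w + w') x * ⟨1, 2⟩ + ψ (w + w') β * star (ψ (w + w') x * ⟨1, 2⟩))
      (ψ (w + w') γ * (ψ (w + w') x * ⟨1, 2⟩)) (-ψ (w + w') x₀) (∑ v ∈ Y, ψ (w + w') v)
      (by linear_combination h)
    simp only [hψ] at h'
    exact z4char_sum_ne_zero φ (w + w') hY (eq_zero_of_det_mul h' hD hN)
  obtain ⟨hj, hj'⟩ := two_mul_eq_zero_of_exclusions _ _ _ _ X1 X2 X3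
  -- the real characters `2w, 2w', 2(w+w')` are `1` at `β`, hence all `≠ 1` at `γ`: contradiction
  have hβw : ψ (w + w) β = 1 := by
    rw [hψ, z4pair_two, hj, ZMod.val_zero, pow_zero]
  have hβw' : ψ (w' + w') β = 1 := by
    rw [hψ, z4pair_two, hj', ZMod.val_zero, pow_zero]
  have hβww' : ψ ((w + w') + (w + w')) β = 1 := by
    rw [hψ, z4pair_two, z4pair_add_left, mul_add, hj, hj', add_zero, ZMod.val_zero, pow_zero]
  have h2w0 : w + w ≠ 0 := by
    intro h
    have := z4pair_two w (φ (y - x))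
    rw [h, hwP, mul_one] at this
    simp only [Prod.fst_zero, Prod.snd_zero, zero_mul, add_zero] at this; exact absurd this (by decide)
  have h2w'0 : w' + w' ≠ 0 := by
    intro h
    have := z4pair_two w' (φ (z - x))
    rw [h, hw'Q, mul_one] at this
    simp only [Prod.fst_zero, Prod.snd_zero, zero_mul, add_zero] at this; exact absurd this (by decide)
  have h2ww'0 : (w + w') + (w + w') ≠ 0 := by
    intro h
    have := z4pair_two (w + w') (φ (y - x))
    rw [h, hww'P, mul_one] at this
    simp only [Prod.fst_zero, Prod.snd_zero, zero_mul, add_zero] at this; exact absurd this (by decide)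
  have G1 : ψ (w + w) γ ≠ 1 := fun h => R2 _ h2w0 (hreal2 w) ⟨hβw, h⟩
  have G2 : ψ (w' + w') γ ≠ 1 := fun h => R2 _ h2w'0 (hreal2 w') ⟨hβw', h⟩
  have G3 : ψ ((w + w') + (w + w')) γ ≠ 1 := fun h => R2 _ h2ww'0 (hreal2 (w + w')) ⟨hβww', h⟩
  apply G3
  rw [hψ, z4pair_two] at G1 G2
  rw [hψ, z4pair_two, z4pair_add_left, mul_add]
  exact ipow_two_mul_add _ _ G1 G2

/-- **Core theorem, parts swapped**: the same with `|Y| = 3` and `|X|` odd (the identity is symmetric under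
`(X, β) ↔ (Y, γ)`). [folklore] -/
theorem no_shifted_form_three_of_onto_z4z4' (φ : A →+ ZMod 4 × ZMod 4) (hφ : Function.Surjective φ)
    {X Y : Finset A} {β γ x₀ : A} (hX : Odd X.card) (hY : Y.card = 3)
    (hinj : Set.InjOn (fun p : A × A => p.1 + p.2) ↑(X ×ˢ Y))
    (hPQ : Disjoint ((X ×ˢ Y).image fun p : A × A => p.1 + p.2)
      (((Y ×ˢ X).image fun p : A × A => p.1 - p.2).image fun z => z + β))
    (hPR : Disjoint ((X ×ˢ Y).image fun p : A × A => p.1 + p.2)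
      (((X ×ˢ Y).image fun p : A × A => p.1 - p.2).image fun z => z + γ))
    (hQR : Disjoint (((Y ×ˢ X).image fun p : A × A => p.1 - p.2).image fun z => z + β)
      (((X ×ˢ Y).image fun p : A × A => p.1 - p.2).image fun z => z + γ))
    (hcover : ((X ×ˢ Y).image fun p : A × A => p.1 + p.2) ∪
      (((Y ×ˢ X).image fun p : A × A => p.1 - p.2).image fun z => z + β) ∪
      (((X ×ˢ Y).image fun p : A × A => p.1 - p.2).image fun z => z + γ) = univ.erase x₀) : False := by
  have himg := image_add_swap X Y
  refine no_shifted_form_three_of_onto_z4z4 φ hφ (X := Y) (Y := X) (β := γ) (γ := β) (x₀ := x₀) hY hX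
    (injOn_add_swap hinj) ?_ ?_ hQR.symm ?_
  · rw [himg]; exact hPR
  · rw [himg]; exact hPQ
  · rw [himg, union_right_comm]; exact hcover

end Main

/-! ## The TPP statements -/

section DihedralLike

variable {A : Type} [AddCommGroup A] [DecidableEq A] [Fintype A] {G : Type} [Group G] [DecidableEq G]
  {ρ τ : A → G} {c₀ : A} {S T U : Finset G}

open Literature.Combinatorics.Additive

/-- **No `(1,1 | 3,3 | e,e)` law triple over `A ↠ ℤ₄ × ℤ₄`.**  Dihedral-like `G` over `A` (any `c₀`), `φ : A →+ ZMod 4 × ZMod 4`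
onto; a TPP triple whose coset parts have sizes `|S₀| = |S₁| = 1`, `|T₀| = |T₁| = 3`, `|U₀| = |U₁|`.  Then
`3|S||T||U| + 8 ≠ 8|A|`. [folklore] -/
theorem no_law_cube_13e_of_onto_z4z4
    (hρρ : ∀ a b, ρ a * ρ b = ρ (a + b)) (hρτ : ∀ a b, ρ a * τ b = τ (b - a))
    (hτρ : ∀ a b, τ a * ρ b = τ (a + b)) (hττ : ∀ a b, τ a * τ b = ρ (c₀ + b - a))
    (hρ : Function.Injective ρ) (hτ : Function.Injective τ) (hne : ∀ a b, ρ a ≠ τ b)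
    (hsurj : ∀ g, (∃ a, ρ a = g) ∨ (∃ a, τ a = g))
    (φ : A →+ ZMod 4 × ZMod 4) (hφ : Function.Surjective φ)
    (h : TripleProductProperty S T U)
    (hS₀ : (univ.filter fun a : A => ρ a ∈ S).card = 1) (hS₁ : (univ.filter fun a : A => τ a ∈ S).card = 1)
    (hT₀ : (univ.filter fun a : A => ρ a ∈ T).card = 3) (hT₁ : (univ.filter fun a : A => τ a ∈ T).card = 3)
    (hU : (univ.filter fun a : A => ρ a ∈ U).card = (univ.filter fun a : A => τ a ∈ U).card)
    (hV : 3 * (S.card * T.card * U.card) + 8 = 8 * Fintype.card A) : False := by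
  classical
  obtain ⟨X, Y, β, γ, x₀, hXc, -, hinj, hPQ, hPR, hQR, hcover⟩ :=
    domino_shifted_form_of_law hρρ hρτ hτρ hττ hρ hτ hne hsurj h hS₀ hS₁ (by rw [hT₀, hT₁]) hU hV
  rw [hT₀] at hXc
  have hYodd := (odd_cards_of_shifted_form (even_card_of_onto_z4z4 φ hφ) hinj hPQ hPR hQR hcover).2
  exact no_shifted_form_three_of_onto_z4z4 φ hφ hXc hYodd hinj hPQ hPR hQR hcover

/-- **No `(1,1 | d,d | 3,3)` law triple over `A ↠ ℤ₄ × ℤ₄`** (the size-`3` parts in `U`). [folklore] -/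
theorem no_law_cube_1d3_of_onto_z4z4
    (hρρ : ∀ a b, ρ a * ρ b = ρ (a + b)) (hρτ : ∀ a b, ρ a * τ b = τ (b - a))
    (hτρ : ∀ a b, τ a * ρ b = τ (a + b)) (hττ : ∀ a b, τ a * τ b = ρ (c₀ + b - a))
    (hρ : Function.Injective ρ) (hτ : Function.Injective τ) (hne : ∀ a b, ρ a ≠ τ b)
    (hsurj : ∀ g, (∃ a, ρ a = g) ∨ (∃ a, τ a = g))
    (φ : A →+ ZMod 4 × ZMod 4) (hφ : Function.Surjective φ)
    (h : TripleProductProperty S T U)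
    (hS₀ : (univ.filter fun a : A => ρ a ∈ S).card = 1) (hS₁ : (univ.filter fun a : A => τ a ∈ S).card = 1)
    (hT : (univ.filter fun a : A => ρ a ∈ T).card = (univ.filter fun a : A => τ a ∈ T).card)
    (hU₀ : (univ.filter fun a : A => ρ a ∈ U).card = 3) (hU₁ : (univ.filter fun a : A => τ a ∈ U).card = 3)
    (hV : 3 * (S.card * T.card * U.card) + 8 = 8 * Fintype.card A) : False := by
  classical
  obtain ⟨X, Y, β, γ, x₀, -, hYc, hinj, hPQ, hPR, hQR, hcover⟩ :=
    domino_shifted_form_of_law hρρ hρτ hτρ hττ hρ hτ hne hsurj h hS₀ hS₁ hT (by rw [hU₀, hU₁]) hV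
  rw [hU₀] at hYc
  have hXodd := (odd_cards_of_shifted_form (even_card_of_onto_z4z4 φ hφ) hinj hPQ hPR hQR hcover).1
  exact no_shifted_form_three_of_onto_z4z4' φ hφ hXodd hYc hinj hPQ hPR hQR hcover

end DihedralLike

end Summit.MatrixMultiplication.OmegaCensus
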